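import Summits.QuantumFields.YangMills.Theorems.BalabanUVNodesN11CondLawInFibreChartInnerFamily

/-!
# DAG node N11 — THE SEPARATED PRESENTATION ASSEMBLED (kernel level): fibrewise inside charts + the un-charted outside averaging `a₁ × id` give the fibre chart of
# the whole skew averaging `U ↦ (a₁ U_out, a_in U)` w.r.t. `μ_out ⊗ μ_in`, WITH THE OUTER FACTOR EXPLICIT — every density at once

HEADER — WORK-UNIT METADATA.  Cell `pub-ymgap`, YM-PLAN Track A (HUMAN RULING D-0062), seat `pub-ymgap-dag-n08-w2` (g8; WIDTH SEAT 2∕4 on N08 [B10],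
RE-POINTED to N11's [III] §3-supply residue), route `BalabanUVNodes` rev 27, key item K1⁷ `StabilityBAtRecordR13SepCoPH` = stmt-QuantumFields-20542 (helper lane,
`--kind proof --supports 20542 --as helper`, count-neutral; KEY MAP of 2026-08-28: K1⁷ is `aside` behind K1⁸ stmt-QuantumFields-26907 — this is (B4)-socket bookkeeping,
not a K1-face file).  [I] = [Balaban1987RG1], [III] = [Balaban1988Convergent], [15] = [Balaban1985Variational].
FILE 5 of this seat's kernel-level socket: FILE 1 `…N11CondLawInFibreChart` (p611747 ✓ — the socket `hchart` ⇒ the conditional law in the chart, every density at once),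
FILE 2 `…N11TStepInFibreChart` (p613290→p618553 ✓ — def-T's (†) ∕ pre-𝐑 slots ∕ first step in chart currency), FILE 3 `…N11CondLawInFibreChartComposition` (p615387 ✓ —
windowed charts compose with un-charted disintegrations; the outer factor `a₁ × id` abstractly), FILE 4 `…N11CondLawInFibreChartInnerFamily` (p616825 ✓ — fibrewise inside
charts give the windowed chart of the recoordinatised inner step).  Companions (per-density, fixed charted set; CITED, not restated): dag-n11-d g14's
`…N11KernelTransportSkewInnerChart.kernelTransport_skew_ae_eq_of_innerChart` (p612397 ★★★) and dag-n11-w2 g3's `…N11KernelTransportSkewProduct.kernelTransport_prodMap_id_ae_eq`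
∕ `map_prodMap_id_absolutelyContinuous` (p611138).

WHY THIS FILE.  FILES 3–4 leave the separated presentation of [III] §3 pp. 267–270 («inside variables charted fibrewise in the outside variables, outside variables
transported by the true conditional law») assembled BY NAME only, with the OUTER factor abstract: FILE 3 §2 reads `margDensity (ν_out ⊗ μ_in) (μ_out ⊗ μ_in) (a₁ × id)`
and `condLaw (ν_out ⊗ μ_in) (a₁ × id)`.  Every consumer — def-T's (†) `tstepOfRecord` through FILE 2, dag-n11-d's (O3′) road — reads the outside factor as THE OUTSIDE
AVERAGING's own transport `margDensity ν_out μ_out a₁ v₁ · ∫ condLaw(ν_out, a₁)(v₁, du₁) …`.  THIS FILE closes that gap and states the end-to-end theorem: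
(§1) `(ν_out ⊗ μ_in).map (a₁ × id) = (μ_out ⊗ μ_in).withDensity (margDensity ν_out μ_out a₁ ∘ fst)` (Mathlib `prod_withDensity_left` + def-T `withDensity_margDensity`), hence
★★ `margDensity (ν_out ⊗ μ_in) (μ_out ⊗ μ_in) (a₁ × id) (v₁,v₂) = margDensity ν_out μ_out a₁ v₁` for `(μ_out ⊗ μ_in)`-a.e. `(v₁,v₂)` (`rnDeriv_withDensity`), and the transfer of
`((ν_out.map a₁) ⊗ μ_in)`-a.e. statements (FILE 3 §3 ★★ `condLaw_prod_map_id_ae_eq`: `condLaw (ν_out⊗μ_in) (a₁×id) (v₁,v₂) = condLaw ν_out a₁ v₁ ⊗ δ_{v₂}`) to `μ_out ⊗ μ_in`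
WHEREVER the outside density is non-zero (`ae_withDensity_iff`) — where it vanishes every face below is `0 = 0`;
(§2) ★★★ from the fibrewise inside identity `hfib` ALONE (FILE 4's hypothesis, `ν_out`-a.e. `u_out`) and `ν_out.map a₁ ≪ μ_out`: FILE 1's hypothesis `hchart` for the WHOLE skew
averaging `U ↦ (a₁ U_out, a_in U)` w.r.t. `μ_out ⊗ μ_in` — FILE 4 ★★★ at the inner step `f U := (U_out, a_in U)` composed by FILE 3 ★★★ with the un-charted `g := a₁ × id`; the
window is the FIXED subset `{U | (U_out, (a_in U, U_in)) ∈ 𝒮_in}` of the fine carrier read through the graph (the `(u_out, v_in)`-dependence of the inside window is absorbed by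
`v_in = a_in U` on the graph);
(§3) ★★★ for `(μ_out ⊗ μ_in)`-a.e. `(v₁,v₂)` and EVERY measurable `ρ ≥ 0`: `margDensity ν μ avg (v₁,v₂) · ∫⁻_{window} ρ dcondLaw(ν,avg)(v₁,v₂) = margDensity ν_out μ_out a₁ v₁ ·
∫⁻ condLaw(ν_out,a₁)(v₁,du₁) ∫⁻ κ_in((u₁,v₂),dx) J_in((u₁,v₂),x)·ρ(u₁, Ψ_in((u₁,v₂),x))`, and ★★ the same AS MEASURES on the fine carrier;
(§4) ★★★ for `(μ_out ⊗ μ_in)`-a.e. `(v₁,v₂)` and EVERY measurable real `ρ` vanishing off the window with integrable chart reading: def-T's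
`kernelTransport (ν_out⊗ν_in) (μ_out⊗μ_in) avg ρ (v₁,v₂) = kernelTransport ν_out μ_out a₁ (u₁ ↦ ∫ J_in((u₁,v₂),x)·ρ(u₁,Ψ_in((u₁,v₂),x)) κ_in((u₁,v₂),dx)) v₁` — dag-n11-d's ★★★
per-density shape with the null set UNIFORM IN `ρ` (what (†) needs: `ρ = ρ_{V′}` varies with the new field).
So the kernel-level chain FILE 4 → FILE 3 → FILE 1 (→ FILE 2 at the record) is ONE theorem whose only chart input is `hfib` — what a Lie–Haar ∕ chart seat delivers for
Bałaban's inside chart (axial gauge ∘ exponential chart at the background ∘ (47) of [15], window (3.2)–(3.5) read at `(u_out, v_in)`).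

WHAT THIS FILE PROVES (0 `def`, 0 `sorry`, standard axioms; generic measurable spaces `β_out β_in α_out α_in X`).
§1 `rnNN_withDensity_ae_eq` · `map_prodMap_id_eq_withDensity_prod` · ★★ `margDensity_prodMap_id_ae_eq` · `ae_prod_of_ae_map_prodMap_id`.
§2 `absolutelyContinuous_map_prodMap_id` · `measurableSet_skewWindow` · ★★★ `chart_skew_of_fibrewise`.
§3 ★★★ `ae_forall_lintegral_condLaw_skew_eq_chart` · ★★ `ae_condLaw_skew_restrict_eq_chart`.
§4 ★★★ `ae_forall_kernelTransport_skew_eq_chart` · ★★ `ae_forall_integral_compositeKernel_eq` (the unfolding of the composite fibre measure, every integrand at once).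

HONEST FRAMING.  Helper lane of K1⁷ (aside); count-neutral; pure measure theory (Mathlib `prod_withDensity_left`, `rnDeriv_withDensity`, `ae_withDensity_iff`,
`Kernel.compProd_apply_eq_compProd_sectR`, `Measure.integral_compProd`, `integral_map`) over def-T's `T4AveragingDisintegration` and FILES 1∕3∕4; NO chart of Bałaban's is
constructed and NO Jacobian computed — the fibrewise inside identity `hfib` stays the HYPOTHESIS a Lie–Haar ∕ chart seat discharges; `ν.map avg ≪ μ_out ⊗ μ_in` (def-T's
`HaarAC` at the record) is displayed; nothing of Bałaban ([I] §2, [III] §3 (3.10)–(3.25), [15] Sect. C (47)–(49)) is asserted; (S-α) ∕ (B4) NOT closed; N11 NOT discharged;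
N08 untouched; K1⁷ ∕ K1⁸ NOT closed, no registered stub touched; counts unmoved (typed 28∕28 · discharged 5∕27 · A 5∕28).  One finite `𝕋⁴_{L^K}` programme at fixed
`ε = L^{−K}`; R4 closes only the conditional finite-𝕋⁴ rung `BalabanLadder.UV` — NOT ℝ⁴, NOT OS, NOT a mass gap, NOT Clay.  No `sorry`, `axiom`, `def`, `instance`, `notation`.
Sources (SHAPE ∕ bookkeeping only): [I] (0.4) p.253, Sect. 2 pp.260–262; [III] (2.21) p.258, (3.1) p.264, (3.2)–(3.5) p.265, (3.10)–(3.11) p.266, p.267 L18–24, p.270 L3–6;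
[15] (47)–(49) pp.287–288.
-/

noncomputable section

open MeasureTheory ProbabilityTheory
open scoped ENNReal NNReal

namespace Summit.QuantumFields.YangMills.Theorems.BalabanUVNodesN11CondLawInFibreChartSkewAssembly

open Literature.MathematicalPhysics.QuantumFieldTheory.Balaban1983to89
open Literature.MathematicalPhysics.QuantumFieldTheory.Balaban1983to89.T4AveragingDisintegration
open Literature.MathematicalPhysics.QuantumFieldTheory.Balaban1983to89.T4TermReprCoupling (rnNN)
open BalabanUVNodesN11CondLawInFibreChart BalabanUVNodesN11CondLawInFibreChartComposition BalabanUVNodesN11CondLawInFibreChartInnerFamily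

/-! ## §1  The OUTER marginal density of the separated presentation is the outside one: `margDensity (ν₁⊗μ₂) (μ₁⊗μ₂) (a₁×id) = margDensity ν₁ μ₁ a₁ ∘ fst`, a.e. -/

section OuterDensity

variable {α₁ α₂ β₁ : Type*} [MeasurableSpace α₁] [MeasurableSpace α₂] [MeasurableSpace β₁]
variable {ν₁ : Measure β₁} [IsFiniteMeasure ν₁] {μ₁ : Measure α₁} [SigmaFinite μ₁] {μ₂ : Measure α₂} {a₁ : β₁ → α₁}

omit [IsFiniteMeasure ν₁] [SigmaFinite μ₁] in
/-- The `ℝ≥0`-truncated Radon–Nikodym derivative of `μ.withDensity f` w.r.t. `μ` is `f`, `μ`-a.e. (Mathlib `rnDeriv_withDensity`). [folklore] -/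
theorem rnNN_withDensity_ae_eq {α : Type*} [MeasurableSpace α] (μ : Measure α) [SigmaFinite μ] {f : α → ℝ≥0} (hf : Measurable f) :
    rnNN (μ.withDensity fun a => (f a : ℝ≥0∞)) μ =ᵐ[μ] f := by
  filter_upwards [Measure.rnDeriv_withDensity μ hf.coe_nnreal_ennreal] with a ha
  unfold rnNN
  rw [ha, ENNReal.toNNReal_coe]

/-- **THE IMAGE OF THE MIDDLE REFERENCE UNDER THE OUTER STEP**: `(ν₁ ⊗ μ₂).map (a₁ × id) = (μ₁ ⊗ μ₂).withDensity (margDensity ν₁ μ₁ a₁ ∘ fst)` under `ν₁.map a₁ ≪ μ₁`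
(def-T's `withDensity_margDensity` + Mathlib `prod_withDensity_left`). [cite: Balaban1988Convergent, (2.21) p.258, (3.1) p.264 (bookkeeping: outside variables averaged, the rest carried along)] -/
theorem map_prodMap_id_eq_withDensity_prod [SFinite μ₂] (ha₁ : Measurable a₁) (hac : ν₁.map a₁ ≪ μ₁) :
    (ν₁.prod μ₂).map (Prod.map a₁ id) = (μ₁.prod μ₂).withDensity (fun v => (margDensity ν₁ μ₁ a₁ v.1 : ℝ≥0∞)) := by
  rw [← Measure.map_prod_map _ _ ha₁ measurable_id, Measure.map_id, ← withDensity_margDensity ν₁ μ₁ ha₁ hac,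
    prod_withDensity_left (measurable_margDensity.coe_nnreal_ennreal)]

/-- **★★ THE OUTER MARGINAL DENSITY IS THE OUTSIDE ONE**: `margDensity (ν₁ ⊗ μ₂) (μ₁ ⊗ μ₂) (a₁ × id) (v₁, v₂) = margDensity ν₁ μ₁ a₁ v₁` for `(μ₁ ⊗ μ₂)`-a.e. `(v₁, v₂)`
(under `ν₁.map a₁ ≪ μ₁`; the previous lemma + `rnDeriv_withDensity`).  This makes the abstract outer factor of FILE 3 §2 (`margDensity λ μ g`, `λ = ν₁ ⊗ μ₂`,
`g = a₁ × id`) explicit. [cite: Balaban1987RG1, (0.4) p.253; Balaban1988Convergent, (2.21) p.258, (3.1) p.264, (3.10)–(3.11) p.266 (bookkeeping)] -/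
theorem margDensity_prodMap_id_ae_eq [SigmaFinite μ₂] (ha₁ : Measurable a₁) (hac : ν₁.map a₁ ≪ μ₁) :
    (fun v : α₁ × α₂ => margDensity (ν₁.prod μ₂) (μ₁.prod μ₂) (Prod.map a₁ id) v) =ᵐ[μ₁.prod μ₂]
      fun v => margDensity ν₁ μ₁ a₁ v.1 := by
  have hmeas : Measurable (Prod.map a₁ (id : α₂ → α₂)) := ha₁.prodMap measurable_id
  have e : (jointLaw (ν₁.prod μ₂) (Prod.map a₁ (id : α₂ → α₂))).fst =
      (μ₁.prod μ₂).withDensity (fun v => ((fun v : α₁ × α₂ => margDensity ν₁ μ₁ a₁ v.1) v : ℝ≥0∞)) := by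
    rw [jointLaw_fst _ hmeas, map_prodMap_id_eq_withDensity_prod ha₁ hac]
  have h := rnNN_withDensity_ae_eq (μ₁.prod μ₂) (f := fun v : α₁ × α₂ => margDensity ν₁ μ₁ a₁ v.1)
    (measurable_margDensity.comp measurable_fst)
  rw [← e] at h
  exact h

/-- **TRANSFER OF `(ν₁.map a₁ ⊗ μ₂)`-a.e. STATEMENTS**: a property holding `((ν₁ ⊗ μ₂).map (a₁ × id))`-a.e. holds `(μ₁ ⊗ μ₂)`-a.e. WHEREVER the outside marginal density
does not vanish (`ae_withDensity_iff`). [folklore] -/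
theorem ae_prod_of_ae_map_prodMap_id [SFinite μ₂] (ha₁ : Measurable a₁) (hac : ν₁.map a₁ ≪ μ₁) {p : α₁ × α₂ → Prop}
    (h : ∀ᵐ v ∂((ν₁.map a₁).prod μ₂), p v) :
    ∀ᵐ v ∂(μ₁.prod μ₂), margDensity ν₁ μ₁ a₁ v.1 ≠ 0 → p v := by
  rw [← withDensity_margDensity ν₁ μ₁ ha₁ hac, prod_withDensity_left (measurable_margDensity.coe_nnreal_ennreal),
    ae_withDensity_iff (show Measurable (fun z : α₁ × α₂ => (margDensity ν₁ μ₁ a₁ z.1 : ℝ≥0∞)) from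
      (measurable_margDensity.comp measurable_fst).coe_nnreal_ennreal)] at h
  filter_upwards [h] with v hv h0
  exact hv (ENNReal.coe_ne_zero.mpr h0)

end OuterDensity

/-! ## §2  The fibre chart of the WHOLE skew averaging from the fibrewise inside charts alone (FILE 4 ★★★ ∘ FILE 3 ★★★) -/

section Skew

variable {β₁ β₂ α₁ α₂ X : Type*} [MeasurableSpace β₁] [MeasurableSpace β₂] [MeasurableSpace α₁] [MeasurableSpace α₂] [MeasurableSpace X]
variable [StandardBorelSpace β₁] [Nonempty β₁] [StandardBorelSpace α₂] [Nonempty α₂]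
variable {ν₁ : Measure β₁} [IsFiniteMeasure ν₁] {ν₂ : Measure β₂} [SFinite ν₂] {μ₁ : Measure α₁} [SigmaFinite μ₁] {μ₂ : Measure α₂} [IsFiniteMeasure μ₂]
variable {a₁ : β₁ → α₁} {a₂ : β₁ × β₂ → α₂} {κin : Kernel (β₁ × α₂) X} [IsSFiniteKernel κin]
variable {Ψin : (β₁ × α₂) × X → β₂} {Jin : (β₁ × α₂) × X → ℝ≥0} {𝒮in : Set (β₁ × (α₂ × β₂))}

omit [StandardBorelSpace β₁] [Nonempty β₁] [StandardBorelSpace α₂] [Nonempty α₂] [IsFiniteMeasure ν₁] [SigmaFinite μ₁] [IsFiniteMeasure μ₂] in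
/-- Absolute continuity of the OUTER step for the middle reference: `(ν₁ ⊗ μ₂).map (a₁ × id) = (ν₁.map a₁) ⊗ μ₂ ≪ μ₁ ⊗ μ₂` (sibling, by name elsewhere:
dag-n11-w2's `…KernelTransportSkewProduct.map_prodMap_id_absolutelyContinuous`; two lines, restated to keep the import list at FILE 4). [folklore] -/
theorem absolutelyContinuous_map_prodMap_id [SFinite ν₁] [SFinite μ₂] (ha₁ : Measurable a₁) (hac : ν₁.map a₁ ≪ μ₁) :
    (ν₁.prod μ₂).map (Prod.map a₁ id) ≪ μ₁.prod μ₂ := by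
  rw [← Measure.map_prod_map _ _ ha₁ measurable_id, Measure.map_id]
  exact hac.prod Measure.AbsolutelyContinuous.rfl

omit [StandardBorelSpace β₁] [Nonempty β₁] [StandardBorelSpace α₂] [Nonempty α₂] [IsFiniteMeasure ν₁] [SFinite ν₂] [SigmaFinite μ₁]
  [IsFiniteMeasure μ₂] [IsSFiniteKernel κin] in
/-- The window of the whole skew averaging, `{(V, U) | (U_out, (a_in U, U_in)) ∈ 𝒮_in}` — a FIXED subset of the fine carrier read through the graph —, is measurable.
[cite: Balaban1988Convergent, (3.2)–(3.5) p.265 (bookkeeping: the inside window read at the outside variables and the new inside field)] -/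
theorem measurableSet_skewWindow (ha₂ : Measurable a₂) (h𝒮in : MeasurableSet 𝒮in) :
    MeasurableSet {p : (α₁ × α₂) × (β₁ × β₂) | (p.2.1, (a₂ p.2, p.2.2)) ∈ 𝒮in} :=
  (show Measurable (fun p : (α₁ × α₂) × (β₁ × β₂) => (p.2.1, (a₂ p.2, p.2.2))) by fun_prop) h𝒮in

/-- **★★★ THE FIBRE CHART OF THE WHOLE SKEW AVERAGING FROM THE FIBREWISE INSIDE CHARTS ALONE**: for the skew averaging `U ↦ (a₁ U_out, a_in U)` on `β_out × β_in`,
fine reference `dU = ν_out ⊗ ν_in`, coarse reference `dV = μ_out ⊗ μ_in`, outside absolute continuity `ν_out.map a₁ ≪ μ_out`, and a family `(κ_in, Ψ_in, J_in, 𝒮_in)` of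
inside charts satisfying the fibrewise identity for `ν_out`-a.e. `u_out` (FILE 4's `hfib`), FILE 1's hypothesis `hchart` holds for the WHOLE averaging:
`((μ ⊗ₘ κ).withDensity J).map (z ↦ (z.1, (z.2.1.1, Ψ_in z.2))) = (jointLaw ν avg).restrict {(V,U) | (U_out, (a_in U, U_in)) ∈ 𝒮_in}` with the composite fibre kernel
`κ := (condLaw (ν_out ⊗ μ_in) (a₁ × id) weighted by its margDensity) ⊗ₖ prodMkLeft _ κ_in` and Jacobian `J z := J_in z.2` — FILE 4 ★★★ `chart_inner_of_fibrewise` (inner step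
`f U := (U_out, a_in U)`, middle reference `ν_out ⊗ μ_in`) composed by FILE 3 ★★★ `chart_comp_of_disintegration` with the UN-CHARTED outer step `g := a₁ × id`.  The shape of
[III] §3's separated presentation, end to end, at kernel level. [cite: Balaban1987RG1, (0.4) p.253, Sect. 2 pp.260–262; Balaban1988Convergent, (2.21) p.258, (3.1) p.264, (3.2)–(3.5) p.265, (3.10)–(3.11) p.266, p.267 L18–24, p.270 L3–6; Balaban1985Variational, (47)–(49) pp.287–288] -/
theorem chart_skew_of_fibrewise [MeasurableEq β₁] (ha₁ : Measurable a₁) (hac₁ : ν₁.map a₁ ≪ μ₁) (ha₂ : Measurable a₂)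
    (hΨin : Measurable Ψin) (hJin : Measurable Jin) (h𝒮in : MeasurableSet 𝒮in)
    (hfib : ∀ᵐ u₁ ∂ν₁, ((μ₂ ⊗ₘ Kernel.comap κin (Prod.mk u₁) measurable_prodMk_left).withDensity
        (fun z => (Jin ((u₁, z.1), z.2) : ℝ≥0∞))).map (fun z => (z.1, Ψin ((u₁, z.1), z.2))) =
      (jointLaw ν₂ (fun u₂ => a₂ (u₁, u₂))).restrict (Prod.mk u₁ ⁻¹' 𝒮in)) :
    (((μ₁.prod μ₂) ⊗ₘ ((Kernel.withDensity (condLaw (ν₁.prod μ₂) (Prod.map a₁ id))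
          fun V _ => (margDensity (ν₁.prod μ₂) (μ₁.prod μ₂) (Prod.map a₁ id) V : ℝ≥0∞)) ⊗ₖ
        Kernel.prodMkLeft (α₁ × α₂) κin)).withDensity (fun z => (Jin z.2 : ℝ≥0∞))).map
        (fun z => (z.1, (z.2.1.1, Ψin z.2))) =
      (jointLaw (ν₁.prod ν₂) (fun u : β₁ × β₂ => (a₁ u.1, a₂ u))).restrict
        {p : (α₁ × α₂) × (β₁ × β₂) | (p.2.1, (a₂ p.2, p.2.2)) ∈ 𝒮in} := by
  have hchartf := chart_inner_of_fibrewise (ν₁ := ν₁) (μ₂ := μ₂) (κin := κin) ha₂ hΨin hJin h𝒮in hfib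
  have hf : Measurable fun u : β₁ × β₂ => (u.1, a₂ u) := measurable_fst.prodMk ha₂
  have hg : Measurable (Prod.map a₁ (id : α₂ → α₂)) := ha₁.prodMap measurable_id
  have h := chart_comp_of_disintegration (ν := ν₁.prod ν₂) (lam := ν₁.prod μ₂) (μ := μ₁.prod μ₂) (κf := κin)
    (Ψf := fun z : (β₁ × α₂) × X => (z.1.1, Ψin z)) (Jf := Jin) hf hg (absolutelyContinuous_map_prodMap_id ha₁ hac₁)
    (show Measurable (fun z : (β₁ × α₂) × X => (z.1.1, Ψin z)) by fun_prop) hJin (measurableSet_innerWindow h𝒮in) hchartf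
  have hwin : (fun p : (α₁ × α₂) × (β₁ × β₂) => ((fun u : β₁ × β₂ => (u.1, a₂ u)) p.2, p.2)) ⁻¹'
      {p : (β₁ × α₂) × (β₁ × β₂) | p.2.1 = p.1.1 ∧ (p.1.1, (p.1.2, p.2.2)) ∈ 𝒮in} =
      {p : (α₁ × α₂) × (β₁ × β₂) | (p.2.1, (a₂ p.2, p.2.2)) ∈ 𝒮in} := by
    ext p
    simp only [Set.mem_preimage, Set.mem_setOf_eq, true_and]
  rw [hwin] at h
  exact h

/-! ## §3  The conditional law of the whole skew averaging on the window, EVERY `ℝ≥0∞`-DENSITY AT ONCE, with the outer factor explicit -/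

variable [StandardBorelSpace β₂] [Nonempty β₂] [IsFiniteMeasure ν₂]

/-- **★★★ THE SKEW AVERAGING'S CONDITIONAL LAW ON THE WINDOW, EVERY DENSITY AT ONCE, OUTER FACTOR EXPLICIT**: under the hypotheses of ★★★ `chart_skew_of_fibrewise` and
def-T's absolute continuity of the whole averaging `ν.map avg ≪ μ₁ ⊗ μ₂`, for `(μ₁ ⊗ μ₂)`-a.e. `(v₁, v₂)` and EVERY measurable `ρ ≥ 0` on `β_out × β_in`:
`margDensity ν (μ₁⊗μ₂) avg (v₁,v₂) · ∫⁻_{U : (U_out,(a_in U,U_in)) ∈ 𝒮_in} ρ dcondLaw(ν,avg)(v₁,v₂)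
   = margDensity ν_out μ_out a₁ v₁ · ∫⁻ condLaw(ν_out,a₁)(v₁, du₁) ∫⁻ κ_in((u₁,v₂), dx) J_in((u₁,v₂),x) · ρ(u₁, Ψ_in((u₁,v₂),x))`
— FILE 3 ★★ `ae_forall_lintegral_kernelTransport_comp_eq` at the composite chart, then §1 ★★ (`margDensity (ν₁⊗μ₂) (μ₁⊗μ₂) (a₁×id) = margDensity ν₁ μ₁ a₁ ∘ fst` a.e.) and
FILE 3 §3 ★★ `condLaw_prod_map_id_ae_eq` (`condLaw (ν₁⊗μ₂) (a₁×id) (v₁,v₂) = condLaw ν₁ a₁ v₁ ⊗ δ_{v₂}`, transferred to `μ₁ ⊗ μ₂` where the outside density is non-zero —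
where it vanishes both sides are `0`).  This is the face the consumers read: dag-n11-d's ★★★ `kernelTransport_skew_ae_eq_of_innerChart` shape (outside variables
transported by the TRUE conditional law of `a₁`, inside variables charted), with the null set UNIFORM IN `ρ`.
[cite: Balaban1987RG1, (0.4) p.253, Sect. 2 pp.260–262; Balaban1988Convergent, (2.21) p.258, (3.1) p.264, (3.2)–(3.5) p.265, (3.10)–(3.11) p.266, p.267 L18–24, p.270 L3–6; Balaban1985Variational, (47)–(49) pp.287–288] -/
theorem ae_forall_lintegral_condLaw_skew_eq_chart [MeasurableEq β₁] (ha₁ : Measurable a₁) (hac₁ : ν₁.map a₁ ≪ μ₁) (ha₂ : Measurable a₂)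
    (hac : (ν₁.prod ν₂).map (fun u : β₁ × β₂ => (a₁ u.1, a₂ u)) ≪ μ₁.prod μ₂)
    (hΨin : Measurable Ψin) (hJin : Measurable Jin) (h𝒮in : MeasurableSet 𝒮in)
    (hfib : ∀ᵐ u₁ ∂ν₁, ((μ₂ ⊗ₘ Kernel.comap κin (Prod.mk u₁) measurable_prodMk_left).withDensity
        (fun z => (Jin ((u₁, z.1), z.2) : ℝ≥0∞))).map (fun z => (z.1, Ψin ((u₁, z.1), z.2))) =
      (jointLaw ν₂ (fun u₂ => a₂ (u₁, u₂))).restrict (Prod.mk u₁ ⁻¹' 𝒮in)) :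
    ∀ᵐ V ∂(μ₁.prod μ₂), ∀ ρ : β₁ × β₂ → ℝ≥0∞, Measurable ρ →
      (margDensity (ν₁.prod ν₂) (μ₁.prod μ₂) (fun u : β₁ × β₂ => (a₁ u.1, a₂ u)) V : ℝ≥0∞) *
          ∫⁻ U in {U : β₁ × β₂ | (U.1, (a₂ U, U.2)) ∈ 𝒮in}, ρ U ∂(condLaw (ν₁.prod ν₂) (fun u : β₁ × β₂ => (a₁ u.1, a₂ u)) V) =
        (margDensity ν₁ μ₁ a₁ V.1 : ℝ≥0∞) *
          ∫⁻ u₁, ∫⁻ x, (Jin ((u₁, V.2), x) : ℝ≥0∞) * ρ (u₁, Ψin ((u₁, V.2), x)) ∂(κin (u₁, V.2)) ∂(condLaw ν₁ a₁ V.1) := by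
  have hchartf := chart_inner_of_fibrewise (ν₁ := ν₁) (μ₂ := μ₂) (κin := κin) ha₂ hΨin hJin h𝒮in hfib
  have hf : Measurable fun u : β₁ × β₂ => (u.1, a₂ u) := measurable_fst.prodMk ha₂
  have hg : Measurable (Prod.map a₁ (id : α₂ → α₂)) := ha₁.prodMap measurable_id
  have hcomp := ae_forall_lintegral_kernelTransport_comp_eq (ν := ν₁.prod ν₂) (lam := ν₁.prod μ₂) (μ := μ₁.prod μ₂) (κf := κin)
    (Ψf := fun z : (β₁ × α₂) × X => (z.1.1, Ψin z)) (Jf := Jin) hf hg (absolutelyContinuous_map_prodMap_id ha₁ hac₁) hac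
    (show Measurable (fun z : (β₁ × α₂) × X => (z.1.1, Ψin z)) by fun_prop) hJin (measurableSet_innerWindow h𝒮in) hchartf
  have hdens := margDensity_prodMap_id_ae_eq (μ₂ := μ₂) ha₁ hac₁
  have hcond := ae_prod_of_ae_map_prodMap_id (μ₂ := μ₂) ha₁ hac₁ (condLaw_prod_map_id_ae_eq (ν₁ := ν₁) (μ₂ := μ₂) ha₁)
  filter_upwards [hcomp, hdens, hcond] with V hV hVd hVc ρ hρ
  -- the window slice and the averaging are those of `hcomp`, definitionally
  have hwin : {U : β₁ × β₂ | (U.1, (a₂ U, U.2)) ∈ 𝒮in} = Prod.mk V ⁻¹' ((fun p : (α₁ × α₂) × (β₁ × β₂) =>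
      ((fun u : β₁ × β₂ => (u.1, a₂ u)) p.2, p.2)) ⁻¹' {p : (β₁ × α₂) × (β₁ × β₂) | p.2.1 = p.1.1 ∧ (p.1.1, (p.1.2, p.2.2)) ∈ 𝒮in}) := by
    ext U
    simp only [Set.mem_preimage, Set.mem_setOf_eq, true_and]
  have havg : (fun u : β₁ × β₂ => (a₁ u.1, a₂ u)) = (Prod.map a₁ (id : α₂ → α₂)) ∘ fun u : β₁ × β₂ => (u.1, a₂ u) := rfl
  rw [hwin, havg, hV ρ hρ, hVd]
  -- the outer factor: `0` on both sides, or the mapped outside conditional law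
  by_cases h0 : margDensity ν₁ μ₁ a₁ V.1 = 0
  · rw [h0, ENNReal.coe_zero, zero_mul, zero_mul]
  · have hG : Measurable fun w : β₁ × α₂ => ∫⁻ x, (Jin (w, x) : ℝ≥0∞) * ρ (w.1, Ψin (w, x)) ∂(κin w) :=
      (show Measurable (fun z : (β₁ × α₂) × X => (Jin z : ℝ≥0∞) * ρ (z.1.1, Ψin z)) by fun_prop).lintegral_kernel_prod_right'
    rw [hVc h0, lintegral_map hG (show Measurable (fun u₁ : β₁ => (u₁, V.2)) by fun_prop)]

/-- **★★ THE SAME AS MEASURES ON THE FINE CARRIER**: for `(μ₁ ⊗ μ₂)`-a.e. `(v₁, v₂)`,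
`margDensity ν (μ₁⊗μ₂) avg (v₁,v₂) • condLaw(ν,avg)(v₁,v₂)|_{window} = margDensity ν_out μ_out a₁ v₁ • (((condLaw ν_out a₁ v₁ ⊗ δ_{v₂}) ⊗ₘ κ_in).withDensity J_in).map chart`
with `chart (w, x) := (w.1, Ψ_in (w, x))` — FILE 1 ★★★ `condLaw_restrict_window_ae_eq_chart` at the composite chart of §2, the composite fibre measure unfolded
(`Kernel.compProd_apply_eq_compProd_sectR`, `Kernel.withDensity_apply`, `withDensity_const`, `compProd_smul_left`, `withDensity_smul_measure`, `Measure.map_smul`), then §1 ★★ and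
FILE 3 §3 ★★. [cite: Balaban1987RG1, (0.4) p.253, Sect. 2 pp.260–262; Balaban1988Convergent, (2.21) p.258, (3.1) p.264, (3.2)–(3.5) p.265, (3.10)–(3.11) p.266, p.267 L18–24, p.270 L3–6] -/
theorem ae_condLaw_skew_restrict_eq_chart [MeasurableEq β₁] (ha₁ : Measurable a₁) (hac₁ : ν₁.map a₁ ≪ μ₁) (ha₂ : Measurable a₂)
    (hac : (ν₁.prod ν₂).map (fun u : β₁ × β₂ => (a₁ u.1, a₂ u)) ≪ μ₁.prod μ₂)
    (hΨin : Measurable Ψin) (hJin : Measurable Jin) (h𝒮in : MeasurableSet 𝒮in)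
    (hfib : ∀ᵐ u₁ ∂ν₁, ((μ₂ ⊗ₘ Kernel.comap κin (Prod.mk u₁) measurable_prodMk_left).withDensity
        (fun z => (Jin ((u₁, z.1), z.2) : ℝ≥0∞))).map (fun z => (z.1, Ψin ((u₁, z.1), z.2))) =
      (jointLaw ν₂ (fun u₂ => a₂ (u₁, u₂))).restrict (Prod.mk u₁ ⁻¹' 𝒮in)) :
    ∀ᵐ V ∂(μ₁.prod μ₂),
      (margDensity (ν₁.prod ν₂) (μ₁.prod μ₂) (fun u : β₁ × β₂ => (a₁ u.1, a₂ u)) V : ℝ≥0∞) •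
          (condLaw (ν₁.prod ν₂) (fun u : β₁ × β₂ => (a₁ u.1, a₂ u)) V).restrict {U : β₁ × β₂ | (U.1, (a₂ U, U.2)) ∈ 𝒮in} =
        (margDensity ν₁ μ₁ a₁ V.1 : ℝ≥0∞) •
          ((((condLaw ν₁ a₁ V.1).map (fun u₁ => (u₁, V.2))) ⊗ₘ κin).withDensity (fun q => (Jin q : ℝ≥0∞))).map
            (fun q : (β₁ × α₂) × X => (q.1.1, Ψin q)) := by
  have hchart := chart_skew_of_fibrewise (ν₂ := ν₂) (μ₁ := μ₁) ha₁ hac₁ ha₂ hΨin hJin h𝒮in hfib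
  have havg : Measurable fun u : β₁ × β₂ => (a₁ u.1, a₂ u) := (ha₁.comp measurable_fst).prodMk ha₂
  have hM := condLaw_restrict_window_ae_eq_chart (ν := ν₁.prod ν₂) (μ := μ₁.prod μ₂)
    (κ := (Kernel.withDensity (condLaw (ν₁.prod μ₂) (Prod.map a₁ id))
          fun V _ => (margDensity (ν₁.prod μ₂) (μ₁.prod μ₂) (Prod.map a₁ id) V : ℝ≥0∞)) ⊗ₖ Kernel.prodMkLeft (α₁ × α₂) κin)
    (Ψ := fun z : (α₁ × α₂) × ((β₁ × α₂) × X) => (z.2.1.1, Ψin z.2)) (J := fun z : (α₁ × α₂) × ((β₁ × α₂) × X) => Jin z.2)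
    havg hac (show Measurable (fun z : (α₁ × α₂) × ((β₁ × α₂) × X) => (z.2.1.1, Ψin z.2)) by fun_prop) (hJin.comp measurable_snd)
    (measurableSet_skewWindow (α₁ := α₁) ha₂ h𝒮in) hchart
  have hdens := margDensity_prodMap_id_ae_eq (μ₂ := μ₂) ha₁ hac₁
  have hcond := ae_prod_of_ae_map_prodMap_id (μ₂ := μ₂) ha₁ hac₁ (condLaw_prod_map_id_ae_eq (ν₁ := ν₁) (μ₂ := μ₂) ha₁)
  have hdm : Measurable (Function.uncurry fun (V : α₁ × α₂) (_ : β₁ × α₂) => (margDensity (ν₁.prod μ₂) (μ₁.prod μ₂) (Prod.map a₁ id) V : ℝ≥0∞)) :=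
    measurable_margDensity.coe_nnreal_ennreal.comp measurable_fst
  filter_upwards [hM, hdens, hcond] with V hV hVd hVc
  -- the window slice is the fixed set, definitionally
  have hwin : {U : β₁ × β₂ | (U.1, (a₂ U, U.2)) ∈ 𝒮in} = Prod.mk V ⁻¹' {p : (α₁ × α₂) × (β₁ × β₂) | (p.2.1, (a₂ p.2, p.2.2)) ∈ 𝒮in} := rfl
  rw [hwin, hV, Kernel.compProd_apply_eq_compProd_sectR, Kernel.sectR_prodMkLeft, Kernel.withDensity_apply _ hdm, withDensity_const,
    Measure.compProd_smul_left, withDensity_smul_measure, Measure.map_smul, hVd]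
  by_cases h0 : margDensity ν₁ μ₁ a₁ V.1 = 0
  · rw [h0, ENNReal.coe_zero, zero_smul, zero_smul]
  · rw [hVc h0]

/-! ## §4  def-T's kernel transport of the whole skew averaging: outside TRUE transport of the inside chart reading, EVERY REAL DENSITY AT ONCE -/

/-- **★★★ THE SKEW TRANSPORT IS THE OUTSIDE TRANSPORT OF THE INSIDE CHART READING — every real density at once**: under the hypotheses of §3, for `(μ₁ ⊗ μ₂)`-a.e.
`(v₁, v₂)` and EVERY measurable real `ρ` on `β_out × β_in` VANISHING OFF THE WINDOW `{U | (U_out, (a_in U, U_in)) ∈ 𝒮_in}` whose chart reading is integrable on the fibre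
(`J_in · ρ ∘ chart` against `(condLaw ν_out a₁ v₁ ⊗ δ_{v₂}) ⊗ₘ κ_in` — displayed),
`kernelTransport (ν_out ⊗ ν_in) (μ_out ⊗ μ_in) avg ρ (v₁, v₂) = kernelTransport ν_out μ_out a₁ (u₁ ↦ ∫ J_in((u₁,v₂),x) · ρ(u₁, Ψ_in((u₁,v₂),x)) κ_in((u₁,v₂),dx)) v₁` —
dag-n11-d's ★★★ `kernelTransport_skew_ae_eq_of_innerChart` (p612397; ONE density, fixed charted set) with the null set UNIFORM IN `ρ`, i.e. the face def-T's (†)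
`tstepOfRecord` reads for all new sequences `s′` at once (FILE 2).  Proof: FILE 1 ★★★ `ae_forall_kernelTransport_eq_chart` at the composite chart of §2, the composite fibre
measure unfolded (`Kernel.compProd_apply_eq_compProd_sectR`, `Kernel.withDensity_apply`, `withDensity_const`, `compProd_smul_left`), Fubini (`Measure.integral_compProd`),
then §1 ★★ and FILE 3 §3 ★★. [cite: Balaban1987RG1, (0.4) p.253, Sect. 2 pp.260–262; Balaban1988Convergent, (2.21) p.258, (3.1) p.264, (3.2)–(3.5) p.265, (3.10)–(3.11) p.266, p.267 L18–24, p.270 L3–6; Balaban1985Variational, (47)–(49) pp.287–288] -/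
theorem ae_forall_kernelTransport_skew_eq_chart [MeasurableEq β₁] (ha₁ : Measurable a₁) (hac₁ : ν₁.map a₁ ≪ μ₁) (ha₂ : Measurable a₂)
    (hac : (ν₁.prod ν₂).map (fun u : β₁ × β₂ => (a₁ u.1, a₂ u)) ≪ μ₁.prod μ₂)
    (hΨin : Measurable Ψin) (hJin : Measurable Jin) (h𝒮in : MeasurableSet 𝒮in)
    (hfib : ∀ᵐ u₁ ∂ν₁, ((μ₂ ⊗ₘ Kernel.comap κin (Prod.mk u₁) measurable_prodMk_left).withDensity
        (fun z => (Jin ((u₁, z.1), z.2) : ℝ≥0∞))).map (fun z => (z.1, Ψin ((u₁, z.1), z.2))) =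
      (jointLaw ν₂ (fun u₂ => a₂ (u₁, u₂))).restrict (Prod.mk u₁ ⁻¹' 𝒮in)) :
    ∀ᵐ V ∂(μ₁.prod μ₂), ∀ ρ : β₁ × β₂ → ℝ, Measurable ρ → (∀ U, (U.1, (a₂ U, U.2)) ∉ 𝒮in → ρ U = 0) →
      Integrable (fun q : (β₁ × α₂) × X => (Jin q : ℝ) * ρ (q.1.1, Ψin q))
        (((condLaw ν₁ a₁ V.1).map (fun u₁ => (u₁, V.2))) ⊗ₘ κin) →
      kernelTransport (ν₁.prod ν₂) (μ₁.prod μ₂) (fun u : β₁ × β₂ => (a₁ u.1, a₂ u)) ρ V =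
        kernelTransport ν₁ μ₁ a₁ (fun u₁ => ∫ x, (Jin ((u₁, V.2), x) : ℝ) * ρ (u₁, Ψin ((u₁, V.2), x)) ∂(κin (u₁, V.2))) V.1 := by
  have hchart := chart_skew_of_fibrewise (ν₂ := ν₂) (μ₁ := μ₁) ha₁ hac₁ ha₂ hΨin hJin h𝒮in hfib
  have havg : Measurable fun u : β₁ × β₂ => (a₁ u.1, a₂ u) := (ha₁.comp measurable_fst).prodMk ha₂
  have hT := ae_forall_kernelTransport_eq_chart (ν := ν₁.prod ν₂) (μ := μ₁.prod μ₂)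
    (κ := (Kernel.withDensity (condLaw (ν₁.prod μ₂) (Prod.map a₁ id))
          fun V _ => (margDensity (ν₁.prod μ₂) (μ₁.prod μ₂) (Prod.map a₁ id) V : ℝ≥0∞)) ⊗ₖ Kernel.prodMkLeft (α₁ × α₂) κin)
    (Ψ := fun z : (α₁ × α₂) × ((β₁ × α₂) × X) => (z.2.1.1, Ψin z.2)) (J := fun z : (α₁ × α₂) × ((β₁ × α₂) × X) => Jin z.2)
    havg hac (show Measurable (fun z : (α₁ × α₂) × ((β₁ × α₂) × X) => (z.2.1.1, Ψin z.2)) by fun_prop) (hJin.comp measurable_snd)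
    (measurableSet_skewWindow (α₁ := α₁) ha₂ h𝒮in) hchart
  have hdens := margDensity_prodMap_id_ae_eq (μ₂ := μ₂) ha₁ hac₁
  have hcond := ae_prod_of_ae_map_prodMap_id (μ₂ := μ₂) ha₁ hac₁ (condLaw_prod_map_id_ae_eq (ν₁ := ν₁) (μ₂ := μ₂) ha₁)
  have hdm : Measurable (Function.uncurry fun (V : α₁ × α₂) (_ : β₁ × α₂) => (margDensity (ν₁.prod μ₂) (μ₁.prod μ₂) (Prod.map a₁ id) V : ℝ≥0∞)) :=
    measurable_margDensity.coe_nnreal_ennreal.comp measurable_fst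
  filter_upwards [hT, hdens, hcond] with V hV hVd hVc ρ hρ hρ𝒮 hint
  rw [hV ρ hρ (fun U hU => hρ𝒮 U hU)]
  -- unfold the composite fibre measure at `V`
  rw [Kernel.compProd_apply_eq_compProd_sectR, Kernel.sectR_prodMkLeft, Kernel.withDensity_apply _ hdm, withDensity_const,
    Measure.compProd_smul_left, integral_smul_measure, hVd]
  -- the outer factor: `0` on both sides, or the mapped outside conditional law + Fubini
  unfold kernelTransport
  by_cases h0 : margDensity ν₁ μ₁ a₁ V.1 = 0
  · simp only [h0, ENNReal.coe_zero, ENNReal.toReal_zero, zero_smul, NNReal.coe_zero, zero_mul]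
  · have hF : Measurable fun q : (β₁ × α₂) × X => (Jin q : ℝ) * ρ (q.1.1, Ψin q) :=
      (measurable_coe_nnreal_real.comp hJin).mul (hρ.comp (measurable_fst.fst.prodMk hΨin))
    have hG : StronglyMeasurable fun w : β₁ × α₂ => ∫ x, (Jin (w, x) : ℝ) * ρ (w.1, Ψin (w, x)) ∂(κin w) :=
      hF.stronglyMeasurable.integral_kernel_prod_right'
    rw [hVc h0, ENNReal.coe_toReal, smul_eq_mul, Measure.integral_compProd hint,
      integral_map (show Measurable (fun u₁ : β₁ => (u₁, V.2)) by fun_prop).aemeasurable hG.aestronglyMeasurable]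

/-- **★★ INTEGRATION AGAINST THE COMPOSITE FIBRE MEASURE, OUTER FACTOR EXPLICIT — every integrand at once**: for `(μ₁ ⊗ μ₂)`-a.e. `(v₁, v₂)` and EVERY
real `f` on `(β_out × α_in) × X` integrable against `(condLaw ν_out a₁ v₁ ⊗ δ_{v₂}) ⊗ₘ κ_in`, the integral of `f` against the composite fibre kernel of §2 at `(v₁, v₂)` is
`margDensity ν_out μ_out a₁ v₁ · ∫ condLaw(ν_out, a₁)(v₁, du₁) ∫ κ_in((u₁, v₂), dx) f((u₁, v₂), x)` — the unfolding step of §4, recorded for consumers who meet the composite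
kernel through FILE 1 ∕ FILE 2 (e.g. the right side of def-T's (†) in chart currency, `…N11TStepInFibreChart.ae_forall_tstepOfRecord_eq_chart`, at the chart of §2).
[cite: Balaban1988Convergent, (2.21) p.258, (3.1) p.264, (3.10)–(3.11) p.266, p.270 L3–6 (bookkeeping: the iterated integral of the separated presentation)] -/
theorem ae_forall_integral_compositeKernel_eq (ha₁ : Measurable a₁) (hac₁ : ν₁.map a₁ ≪ μ₁) :
    ∀ᵐ V ∂(μ₁.prod μ₂), ∀ f : (β₁ × α₂) × X → ℝ,
      Integrable f (((condLaw ν₁ a₁ V.1).map (fun u₁ => (u₁, V.2))) ⊗ₘ κin) →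
      ∫ q, f q ∂(((Kernel.withDensity (condLaw (ν₁.prod μ₂) (Prod.map a₁ id))
            fun V _ => (margDensity (ν₁.prod μ₂) (μ₁.prod μ₂) (Prod.map a₁ id) V : ℝ≥0∞)) ⊗ₖ Kernel.prodMkLeft (α₁ × α₂) κin) V) =
        (margDensity ν₁ μ₁ a₁ V.1 : ℝ) * ∫ u₁, ∫ x, f ((u₁, V.2), x) ∂(κin (u₁, V.2)) ∂(condLaw ν₁ a₁ V.1) := by
  have hdens := margDensity_prodMap_id_ae_eq (μ₂ := μ₂) ha₁ hac₁
  have hcond := ae_prod_of_ae_map_prodMap_id (μ₂ := μ₂) ha₁ hac₁ (condLaw_prod_map_id_ae_eq (ν₁ := ν₁) (μ₂ := μ₂) ha₁)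
  have hdm : Measurable (Function.uncurry fun (V : α₁ × α₂) (_ : β₁ × α₂) => (margDensity (ν₁.prod μ₂) (μ₁.prod μ₂) (Prod.map a₁ id) V : ℝ≥0∞)) :=
    measurable_margDensity.coe_nnreal_ennreal.comp measurable_fst
  filter_upwards [hdens, hcond] with V hVd hVc f hint
  rw [Kernel.compProd_apply_eq_compProd_sectR, Kernel.sectR_prodMkLeft, Kernel.withDensity_apply _ hdm, withDensity_const,
    Measure.compProd_smul_left, integral_smul_measure, hVd]
  by_cases h0 : margDensity ν₁ μ₁ a₁ V.1 = 0
  · simp only [h0, ENNReal.coe_zero, ENNReal.toReal_zero, zero_smul, NNReal.coe_zero, zero_mul]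
  · -- Fubini needs the inner Bochner integral a.e.-strongly measurable against the mapped outside conditional law
    have hI : Integrable (fun w : β₁ × α₂ => ∫ x, f (w, x) ∂(κin w)) ((condLaw ν₁ a₁ V.1).map (fun u₁ => (u₁, V.2))) := by
      have h := hint
      rw [Measure.compProd] at h
      simpa only [Kernel.prodMkLeft_apply, Kernel.const_apply] using h.integral_compProd
    rw [hVc h0, ENNReal.coe_toReal, smul_eq_mul, Measure.integral_compProd hint,
      integral_map (show Measurable (fun u₁ : β₁ => (u₁, V.2)) by fun_prop).aemeasurable hI.aestronglyMeasurable]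

end Skew

end Summit.QuantumFields.YangMills.Theorems.BalabanUVNodesN11CondLawInFibreChartSkewAssembly

end
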